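import Literature.NumberTheory.Automorphic.CDTTheorem722
import Literature.NumberTheory.Automorphic.CDTTheorem722Proofs
import Literature.NumberTheory.Automorphic.CDTTheorem722ThreeFactsProofs
import Literature.NumberTheory.EllipticCurves.InertiaInvariantsAdditiveProofs
import Literature.NumberTheory.Automorphic.CDTTheorem712
import Literature.NumberTheory.Automorphic.CDTTheorem712TwoLiftsProofs
import Literature.NumberTheory.Automorphic.BCDTTheoremB
import Literature.NumberTheory.EllipticCurves.NewformsLevelEqOfHeckeEigenvalueEqProofs
import Literature.NumberTheory.EllipticCurves.NewformsEqOfHeckeEigenvalueEqProofs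
import Literature.NumberTheory.EllipticCurves.NewformsHeckeProofs
import Literature.NumberTheory.EllipticCurves.NewformGaloisRepEulerFactors
import Literature.NumberTheory.EllipticCurves.Szpiro
import Literature.NumberTheory.EllipticCurves.CuspFormTwist
import Literature.NumberTheory.EllipticCurves.HeckeOperatorsProofs
import Summits.ABC.ABC.Theorems.DefiniteXiFreyModularityIsModular
import HarnessLib

/-!
# Stub ideation k = 2, generation 4, for `stub_threeImpTwo` (S9) of crux `FreyModularity`
# (stmt-ABC-11340, route-ABC-DefiniteXi) — companion of `STUB-IDEAS-stub_threeImpTwo-2.md` (gen 4).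

RESHAPE (family 2), gen-4 delta over gen 3 (`…_2g3_Sketch.lean`, kept for T-A = `h32T ⇐ L_A`):

**T-C · the COMPATIBLE-SYSTEM cut.**  Strengthen the HYPOTHESIS of S9 from "`ρ_{E,ℓ}` modular for ONE
`ℓ`" to "`ρ_{E,p}` modular for EVERY `p`" (`IsModularGaloisRepTateAll`) — which costs the line
nothing, because the two lifting stubs are closed from the catalogued `CDT_theorem_7_2_1/7_2_2`
(conclusion `BCDT.IsModular`) through the PROVED (2) ⇒ (4) `IsModular.isModularGaloisRepTate` at every
prime, not only at `3`/`5` (`sigLiftThreeCS_of_CDT_theorem_7_2_1`, `sigLiftFiveCS_of_CDT_theorem_7_2_2`).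
Under the strengthened hypothesis the `ℓ`-hole of every single-prime road (gen 1–3 of all three
ideators: `a_ℓ(f) = a_ℓ(E)` and `ℓ ∤ N ⇒ E good at ℓ`) is filled by the packet at a SECOND prime, and
the two descended newforms are merged by STRONG MULTIPLICITY ONE ACROSS LEVELS — a theorem of the tree
(`IsNewform0.level_eq_of_heckeEigenvalue_eq_holds`, `IsNewform0.eq_of_heckeEigenvalue_eq_holds`).
Consequences (M0, M1, M2 and all glue PROVED below — the I2 step is kernel-checked with NO named
fact; the one `sorry` is M3 = ideator-1's proved G3.B1∘B2, to be landed from its companion):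
* I2 (switched curve `W'`): `ρ̄_{E,5} = ρ̄_{W',5}` modular from `W'` Tate-modular AT 5 — gen-3 H1 at the
  torsion prime itself; NO named fact (no `L_A`, no Eichler–Shimura, no Carayol);
* I1/I3 (Frey curve) and the ∀W cut: `{Carayol1986_eulerFactor, level = conductor}` only — the
  Eichler–Shimura / `L_A` / congruence-relation + Igusa leaf of every earlier closer is GONE;
* closing set of the whole line: `{langlands_tunnell, CDT_theorem_7_2_1, CDT_theorem_7_2_2,
  CDT_three_five_switch, Carayol1986_eulerFactor, FreyLevelEqConductor}` (`freyModularity_of_recutCS_atoms`).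
-/

noncomputable section

open scoped NumberField Polynomial MatrixGroups ModularForm
open NumberField IsDedekindDomain IsDedekindDomain.HeightOneSpectrum Field Polynomial
open CongruenceSubgroup Rat.HeightOneSpectrum
open Literature.NumberTheory.EllipticCurves
open Literature.NumberTheory.EllipticCurves.ModularForms
open Literature.NumberTheory.Automorphic
open Literature.NumberTheory.Automorphic.BCDT
open Literature.NumberTheory.GaloisRepresentations
open WeierstrassCurve

namespace Summit.ABC.ABC.Cruxes.FreyModularity.Sketch.StubIdeasThreeImpTwo2G4

/-! ## The stub (verbatim) and the compatible-system cuts -/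

/-- The registered stub S9, verbatim. -/
def SigStubThreeImpTwo : Prop :=
  ∀ (W : WeierstrassCurve ℚ) [W.IsElliptic] [NeZero (W.conductorNorm ℤ)] (ℓ : ℕ) [Fact ℓ.Prime],
    W.IsModularGaloisRepTate ℓ → BCDT.IsModular W

/-- BCDT condition (4): `ρ_{E,p}` is modular for EVERY prime `p` (the compatible system). -/
def IsModularGaloisRepTateAll (W : WeierstrassCurve ℚ) : Prop :=
  ∀ (p : ℕ) [Fact p.Prime], W.IsModularGaloisRepTate p

/-- `h32CS` — S9 with the compatible-system hypothesis (∀W). -/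
def SigThreeImpTwoCS : Prop :=
  ∀ (W : WeierstrassCurve ℚ) [W.IsElliptic] [NeZero (W.conductorNorm ℤ)],
    IsModularGaloisRepTateAll W → BCDT.IsModular W

/-- `h32FCS` — the same on Frey curves only (consumers I1, I3). -/
def SigThreeImpTwoFreyCS : Prop :=
  ∀ (a b : ℤ), IsCoprime a b → a * b * (a + b) ≠ 0 →
    ∀ [(freyCurve a b).IsElliptic] [NeZero ((freyCurve a b).conductorNorm ℤ)],
      IsModularGaloisRepTateAll (freyCurve a b) → BCDT.IsModular (freyCurve a b)

/-- S1b with compatible-system OUTPUT (what `R = T` at `3` + Eichler–Shimura at every `p` prints). -/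
def SigLiftThreeCS : Prop :=
  ∀ (W : WeierstrassCurve ℚ) [W.IsElliptic] (ρ : ModPGaloisRep ℚ (ZMod 3) 2),
    W.IsTorsionGaloisRep 3 ρ → ρ.IsAbsIrreducibleOverSqrt (-3) → ¬ 9 ∣ W.conductorNorm ℤ →
    ρ.IsModular → IsModularGaloisRepTateAll W

/-- S2 with compatible-system OUTPUT. -/
def SigLiftFiveCS : Prop :=
  ∀ (W : WeierstrassCurve ℚ) [W.IsElliptic] (ρ : ModPGaloisRep ℚ (ZMod 5) 2),
    W.IsTorsionGaloisRep 5 ρ → ρ.IsAbsIrreducibleOverSqrt 5 → ¬ 25 ∣ W.conductorNorm ℤ →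
    ρ.IsModular → IsModularGaloisRepTateAll W

/-- Carayol's "level = conductor" on the Frey family only (ideator-3's road: the PROVED Frey–Saito
rows + `Carayol1986_artinConductorExponent`, CM corner by the landed `isModular_freyCurve_of_natAbs_eq_two`;
or verbatim from the catalogued ∀W `IsNewformOf.level_eq_conductorNorm`). -/
def FreyLevelEqConductor : Prop :=
  ∀ (a b : ℤ), IsCoprime a b → a * b * (a + b) ≠ 0 →
    ∀ [(freyCurve a b).IsElliptic] {N : ℕ} [NeZero N] {f : CuspForm (Gamma0 N) 2},
      IsNewformOf (freyCurve a b) f → N = (freyCurve a b).conductorNorm ℤ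

/-! ## The strengthened lift stubs cost nothing: closed from the SAME catalogued facts -/

/-- `SigLiftThreeCS ⇐ CDT_theorem_7_2_1` (conclusion `IsModular`, then (2) ⇒ (4) at EVERY prime). -/
theorem sigLiftThreeCS_of_CDT_theorem_7_2_1 (h : CDT_theorem_7_2_1) : SigLiftThreeCS := by
  intro W _ ρ hρ hirr h9 _ p _
  haveI : NeZero (W.conductorNorm ℤ) := ⟨(conductorNorm_pos_holds W).ne'⟩
  exact (h W ρ hρ hirr fun h27 ↦ h9 (dvd_trans ⟨3, rfl⟩ h27)).isModularGaloisRepTate p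

/-- `SigLiftFiveCS ⇐ CDT_theorem_7_2_2`. -/
theorem sigLiftFiveCS_of_CDT_theorem_7_2_2 (h : CDT_theorem_7_2_2) : SigLiftFiveCS := by
  intro W _ ρ hρ hirr _ hmod p _
  haveI : NeZero (W.conductorNorm ℤ) := ⟨(conductorNorm_pos_holds W).ne'⟩
  exact (h W ρ hρ hirr hmod).isModularGaloisRepTate p

/-- The verbatim `FreyLevelEqConductor ⇐` Carayol ∀W. -/
theorem freyLevelEqConductor_of_carayol
    (hC : ∀ (N : ℕ) [NeZero N], IsNewformOf.level_eq_conductorNorm (N := N)) :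
    FreyLevelEqConductor :=
  fun _ _ _ _ _ N _ _ hf ↦ hC N hf

/-- Sanity: the CS cut is WEAKER than S9. -/
theorem sigThreeImpTwoCS_of_stub (h32 : SigStubThreeImpTwo) : SigThreeImpTwoCS := by
  intro W _ _ h
  haveI : Fact (Nat.Prime 3) := ⟨Nat.prime_three⟩
  exact h32 W 3 (h 3)

/-- Sanity: the Frey CS cut is WEAKER than the ∀W CS cut. -/
theorem sigThreeImpTwoFreyCS_of_CS (h : SigThreeImpTwoCS) : SigThreeImpTwoFreyCS :=
  fun a b _ _ _ _ hall ↦ h (freyCurve a b) hall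

/-! ## Helper lemmas (one prover cycle each; M0, M1, M2 and the merge are PROVED here; only M3 is `sorry`) -/

/-- The `X`-coefficient of `X² - a X + b` is `-a` (ideator-1's helper, verbatim). [folklore] -/
theorem coeff_one_X_sq_sub_C_mul_X_add_C' {S : Type*} [CommRing S] (a b : S) :
    (Polynomial.X ^ 2 - Polynomial.C a * Polynomial.X + Polynomial.C b).coeff 1 = -a := by
  simp [Polynomial.coeff_X_pow, Polynomial.coeff_C]

/-- **M0 (descent KEEPING the inertia clause; ideator-1's H1, ported verbatim — PROVED).**
`ρ_{E,ℓ}` modular ⇒ a newform `f₀ ∈ S₂(Γ₀(N))` with `E` good off `N ℓ` (Néron–Ogg–Shafarevich on the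
inertia clause of `IsModularGaloisRepTate`) and `a_p(f₀) = a_p(E)` for `p ∤ N ℓ` (the `X`-coefficient
of the Frobenius polynomial); the tree's `exists_rational_isNewform0_of_isModularGaloisRepTate'`
forgets the good reduction, which the merge below needs. -/
theorem exists_isNewform0_hasGoodReductionAt_of_isModularGaloisRepTate
    (W : WeierstrassCurve ℚ) [W.IsElliptic] (ℓ : ℕ) [Fact ℓ.Prime] (h : W.IsModularGaloisRepTate ℓ) :
    ∃ (N : ℕ) (_ : NeZero N) (f₀ : CuspForm (Gamma0 N) 2), IsNewform0 f₀ ∧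
      (∀ v : HeightOneSpectrum (𝓞 ℚ), ¬ ((primesEquiv v : ℕ) ∣ N * ℓ) → W.HasGoodReductionAt v) ∧
      ∀ p : ℕ, p.Prime → ¬ p ∣ N * ℓ → cuspCoeff f₀ p = (W.LFunction p : ℂ) := by
  classical
  have hℓp : ℓ.Prime := Fact.out
  obtain ⟨N, hN, f, K, hK, hA, ι, hnew, hε, hcl⟩ := (isModularGaloisRepTate_iff_weight_two W ℓ).mp h
  -- descent to `Γ₀(N)`
  have hdia : ∀ d : ZMod N, IsUnit d → diamondOp N 2 d f = f := by
    intro d hd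
    obtain ⟨u, rfl⟩ := hd
    rw [hnew.diamondOp_apply_eq_nebentypus_smul u, hε, MulChar.one_apply_coe, one_smul]
  obtain ⟨f₀, hf₀⟩ := exists_liftToGamma1_eq_of_forall_diamondOp_eq 2 f hdia
  have hnew₀ : IsNewform0 f₀ := (isNewform1_liftToGamma1_iff_holds N 2 f₀).mp (hf₀ ▸ hnew)
  have hcoe : (⇑f₀ : UpperHalfPlane → ℂ) = ⇑f := by rw [← hf₀, coe_liftToGamma1_holds]
  -- good reduction off `N ℓ`: Néron–Ogg–Shafarevich
  have hgood : ∀ v : HeightOneSpectrum (𝓞 ℚ), ¬ ((primesEquiv v : ℕ) ∣ N * ℓ) →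
      W.HasGoodReductionAt v := by
    intro v hv
    have hpℓ : (primesEquiv v : ℕ) ≠ ℓ := fun h' ↦ hv (by rw [← h']; exact dvd_mul_left _ _)
    have hℓv : ((ℓ : ℕ) : 𝓞 ℚ) ∉ v.asIdeal := by
      rw [Literature.NumberTheory.GaloisRepresentations.Rat.natCast_mem_asIdeal_iff]
      exact fun h' ↦ hpℓ ((Nat.prime_dvd_prime_iff_eq (primesEquiv v).2 hℓp).mp h')
    exact W.neronOggShafarevich_holds v ℓ hℓv fun 𝔓 h𝔓 τ hτ ↦ (hcl v hv 𝔓 h𝔓).1 τ hτ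
  refine ⟨N, hN, f₀, hnew₀, hgood, fun p hp hpNℓ ↦ ?_⟩
  -- the place `v` of `ℚ` at `p`, a prime of `ℤ̄` above it and an arithmetic Frobenius
  obtain ⟨v, rfl⟩ : ∃ v : HeightOneSpectrum (𝓞 ℚ), (primesEquiv v : ℕ) = p :=
    ⟨primesEquiv.symm ⟨p, hp⟩, by rw [Equiv.apply_symm_apply]⟩
  obtain ⟨𝔓, h𝔓⟩ := primesAbove_nonempty v
  obtain ⟨σ, hσ⟩ := exists_isArithFrobAt_of_mem_primesAbove_holds (v := v) h𝔓
  have hpℓ : (primesEquiv v : ℕ) ≠ ℓ := fun h' ↦ hpNℓ (by rw [← h']; exact dvd_mul_left _ _)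
  have hgoodv : W.HasGoodReductionAt v := hgood v hpNℓ
  have hℓv : ((ℓ : ℕ) : 𝓞 ℚ) ∉ v.asIdeal := by
    rw [Literature.NumberTheory.GaloisRepresentations.Rat.natCast_mem_asIdeal_iff]
    exact fun h' ↦ hpℓ ((Nat.prime_dvd_prime_iff_eq hp hℓp).mp h')
  have htr := W.trace_galoisRepTate_frobenius_of_hasGoodReductionAt_holds ℓ v hℓv hgoodv h𝔓 hσ
  -- compare the `X`-coefficients of the two characteristic polynomials
  have h1 := congrArg (fun P : Polynomial K ↦ P.coeff 1) ((hcl v hpNℓ 𝔓 h𝔓).2 σ hσ)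
  rw [Polynomial.coeff_map, Polynomial.coeff_map, coeff_one_X_sq_sub_C_mul_X_add_C',
    Literature.NumberTheory.EllipticCurves.ModularForms.heckePolynomial,
    coeff_one_X_sq_sub_C_mul_X_add_C', map_neg, map_neg, neg_inj, htr, map_intCast,
    ← map_intCast ι] at h1
  have h2 := congrArg Subtype.val (ι.injective h1)
  change (((W.frobeniusTraceAt v : ℤ) : coeffCharField f) : ℂ) =
    (UpperHalfPlane.qExpansion 1 ⇑f).coeff (primesEquiv v : ℕ) at h2
  rw [cuspCoeff, hcoe, W.lFunction_primesEquiv_eq_frobeniusTraceAt hgoodv, ← h2]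
  norm_cast

/-- **M1 (NEW; strong multiplicity one across levels, coefficient form; S ≈ 25 lines — PROVED here).**
Two `Γ₀` newforms of weight `2` whose prime coefficients agree off a finite modulus have the same
level and the same `q`-expansion. -/
theorem level_eq_and_cuspCoeff_eq_of_cuspCoeff_eq_off {N₁ N₂ : ℕ} [NeZero N₁] [NeZero N₂]
    {f₁ : CuspForm (Gamma0 N₁) 2} {f₂ : CuspForm (Gamma0 N₂) 2} (hf₁ : IsNewform0 f₁)
    (hf₂ : IsNewform0 f₂) {M : ℕ} (hM : M ≠ 0)
    (h : ∀ p : ℕ, p.Prime → ¬ p ∣ M → cuspCoeff f₁ p = cuspCoeff f₂ p) :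
    ∃ e : N₁ = N₂, ∀ n : ℕ, cuspCoeff f₁ n = cuspCoeff (e ▸ f₂) n := by
  have hfin : {p : ℕ | p.Prime ∧ heckeEigenvalue f₁ p ≠ heckeEigenvalue f₂ p}.Finite := by
    refine M.primeFactors.finite_toSet.subset ?_
    rintro p ⟨hp, hne⟩
    refine (Nat.mem_primeFactors_of_ne_zero hM).mpr ⟨hp, ?_⟩
    by_contra hpM
    apply hne
    rw [heckeEigenvalue_eq_coeff_of_isNormalized hf₁.2.2 hp (hf₁.2.1 p hp),
      heckeEigenvalue_eq_coeff_of_isNormalized hf₂.2.2 hp (hf₂.2.1 p hp)]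
    exact h p hp hpM
  have hN : N₁ = N₂ := IsNewform0.level_eq_of_heckeEigenvalue_eq_holds hf₁ hf₂ hfin
  subst hN
  refine ⟨rfl, fun n ↦ ?_⟩
  rw [IsNewform0.eq_of_heckeEigenvalue_eq_holds hf₁ hf₂ hfin]

section PacketPort
open UpperHalfPlane

/-- A `Γ₀(M)`-newform is non-zero (`a₁ = 1`) — verbatim copy of the tree's
`IsNewform0.ne_zero_of_isNormalized` (`BCDTModularityTwistProofs`, unbuilt on the snapshot). [folklore] -/
theorem isNewform0_ne_zero_of_isNormalized {M : ℕ} [NeZero M] {k : ℤ} {g : CuspForm (Gamma0 M) k}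
    (hg : IsNewform0 g) : g ≠ 0 := by
  intro h
  have h1 : cuspCoeff g 1 = 1 := hg.2.2
  rw [h, cuspCoeff_zero_form (one_mem_strictPeriods_gamma0 M)] at h1
  exact zero_ne_one h1

/-- **An integral newform packet makes `ρ̄` modular** — VERBATIM copy of the tree's
`Literature.NumberTheory.Automorphic.BCDT.isModular_of_isNewform0_packet`
(`BCDTModularityTwistProofs`, l. 134), inlined only because that module is unbuilt on the current
farm snapshot (`remote:stale:…:unbuilt`); a prover cites the tree decl instead.
[cite: BCDTJAMS2001, Introduction ("ρ̄ is modular")] [cite: DiamondShurman2005, Def. 9.6.4] -/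
theorem isModular_of_isNewform0_packet' {M : ℕ} [NeZero M] {g : CuspForm (Gamma0 M) 2}
    (hg : IsNewform0 g) {ℓ : ℕ} [Fact ℓ.Prime] {b : ℕ → ℤ}
    (hb : ∀ p : ℕ, p.Prime → ¬ p ∣ M * ℓ → cuspCoeff g p = (b p : ℂ))
    {ρ : ModPGaloisRep ℚ (ZMod ℓ) 2}
    (hρ : ∀ v : HeightOneSpectrum (𝓞 ℚ), ¬ ((primesEquiv v : ℕ) ∣ M * ℓ) →
      ρ.IsUnramifiedAt v ∧ ρ.HasFrobCharpolyAt v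
        (X ^ 2 - C ((b (primesEquiv v : ℕ) : ℤ) : ZMod ℓ) * X + C ((primesEquiv v : ℕ) : ZMod ℓ))) :
    ρ.IsModular := by
  classical
  have hℓp : ℓ.Prime := Fact.out
  have hgne : g ≠ 0 := isNewform0_ne_zero_of_isNormalized hg
  -- the newform on `Γ₁(M)` with trivial character
  set f₁ : CuspForm (Gamma1 M) 2 := liftToGamma1 M 2 g with hf₁
  have hnew : IsNewform1 f₁ := (isNewform1_liftToGamma1_iff_holds M 2 g).mpr hg
  have hcoe : (⇑f₁ : ℍ → ℂ) = ⇑g := coe_liftToGamma1_holds _ 2 g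
  have hε : nebentypus f₁ = 1 := nebentypus_liftToGamma1_holds _ 2 hgne
  -- a prime `𝔪` of the coefficient ring `𝓞_f` above `ℓ`, and `K = 𝓞_f / 𝔪 ⊇ 𝔽_ℓ`
  haveI : Algebra.IsIntegral ℤ (coeffCharIntegers f₁) := by
    unfold coeffCharIntegers; infer_instance
  haveI hmax : (Ideal.span {(ℓ : ℤ)}).IsMaximal :=
    PrincipalIdealRing.isMaximal_of_irreducible (Nat.prime_iff_prime_int.mp hℓp).irreducible
  obtain ⟨𝔪, h𝔪max, h𝔪⟩ := Ideal.exists_ideal_over_maximal_of_isIntegral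
    (S := coeffCharIntegers f₁) (Ideal.span {(ℓ : ℤ)}) (fun x hx ↦ by
      rw [RingHom.mem_ker, eq_intCast, Int.cast_eq_zero] at hx
      rw [hx]; exact Ideal.zero_mem _)
  haveI : 𝔪.IsMaximal := h𝔪max
  have hℓ𝔪 : ((ℓ : ℕ) : coeffCharIntegers f₁) ∈ 𝔪 := by
    have h : ((ℓ : ℕ) : ℤ) ∈ 𝔪.comap (algebraMap ℤ (coeffCharIntegers f₁)) := by
      rw [h𝔪]; exact Ideal.mem_span_singleton_self _
    rwa [Ideal.mem_comap, map_natCast] at h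
  let K : Type := coeffCharIntegers f₁ ⧸ 𝔪
  letI : Field K := Ideal.Quotient.field 𝔪
  letI : TopologicalSpace K := ⊥
  haveI : DiscreteTopology K := ⟨rfl⟩
  have hℓK : ((ℓ : ℕ) : K) = 0 := by
    rw [← map_natCast (Ideal.Quotient.mk 𝔪), Ideal.Quotient.eq_zero_iff_mem]
    exact hℓ𝔪
  haveI : CharP K ℓ := (CharP.charP_iff_prime_eq_zero hℓp).mpr hℓK
  let j : ZMod ℓ →+* K := ZMod.castHom (dvd_refl ℓ) K
  let ι : coeffCharIntegers f₁ →+* K := Ideal.Quotient.mk 𝔪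
  refine ⟨M, inferInstance, 2, f₁, K, inferInstance, inferInstance, inferInstance, j, ι, by norm_num,
    hnew, ?_⟩
  -- `ρ̄ ⊗ K` is attached to `f₁` away from `M ℓ`
  intro v hv
  have hpp : (primesEquiv v : ℕ).Prime := (primesEquiv v).2
  rw [ZMod.ringChar_zmod_n] at hv
  have hv' : ¬ ((primesEquiv v : ℕ) ∣ M * ℓ) := hv
  have hpM : ¬ (primesEquiv v : ℕ) ∣ M := fun h ↦ hv' (dvd_mul_of_dvd_left h _)
  obtain ⟨hunr, hfrob⟩ := hρ v hv'
  refine ⟨?_, ?_⟩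
  · -- unramified at `p`
    intro 𝔓 h𝔓 τ hτ
    rw [FramedRep.baseChange_apply, hunr 𝔓 h𝔓 τ hτ, map_one]
  · -- the Hecke polynomial `X² - b_p X + p`, integrally, and the Frobenius characteristic polynomial
    have hap : (qExpansion 1 ⇑f₁).coeff (primesEquiv v : ℕ) = ((b (primesEquiv v : ℕ) : ℤ) : ℂ) := by
      rw [hcoe]; exact hb _ hpp hv'
    have hεp : (nebentypus f₁ ((primesEquiv v : ℕ) : ZMod M) : ℂ) *
        ((primesEquiv v : ℕ) : ℂ) ^ ((2 : ℤ) - 1) = ((primesEquiv v : ℕ) : ℂ) := by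
      rw [hε, MulChar.one_apply ((ZMod.isUnit_prime_iff_not_dvd hpp).mpr hpM), one_mul]
      norm_num
    have h1 : (⟨(qExpansion 1 ⇑f₁).coeff (primesEquiv v : ℕ),
        cuspCoeff_mem_coeffCharField f₁ (primesEquiv v : ℕ)⟩ : coeffCharField f₁) =
        ((b (primesEquiv v : ℕ) : ℤ) : coeffCharField f₁) :=
      Subtype.ext (by
        change PowerSeries.coeff _ (qExpansion 1 ⇑f₁) = _
        rw [hap]; norm_cast)
    have h2 : (⟨(nebentypus f₁ ((primesEquiv v : ℕ) : ZMod M) : ℂ) *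
        ((primesEquiv v : ℕ) : ℂ) ^ ((2 : ℤ) - 1),
        nebentypus_mul_zpow_mem_coeffCharField f₁ (primesEquiv v : ℕ)⟩ : coeffCharField f₁) =
        ((primesEquiv v : ℕ) : coeffCharField f₁) :=
      Subtype.ext (by
        change (nebentypus f₁ ((primesEquiv v : ℕ) : ZMod M) : ℂ) *
          ((primesEquiv v : ℕ) : ℂ) ^ ((2 : ℤ) - 1) = _
        rw [hεp]; norm_cast)
    refine ⟨X ^ 2 - C ((b (primesEquiv v : ℕ) : ℤ) : coeffCharIntegers f₁) * X +
      C ((primesEquiv v : ℕ) : coeffCharIntegers f₁), ?_, ?_⟩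
    · rw [Polynomial.map_add, Polynomial.map_sub, Polynomial.map_mul, Polynomial.map_pow,
        Polynomial.map_X, Polynomial.map_C, Polynomial.map_C, map_intCast, map_natCast,
        heckePolynomial, h1, h2]
    · intro 𝔓 h𝔓 σ hσ
      have hch := hfrob 𝔓 h𝔓 σ hσ
      have hmap : (Units.val (Matrix.GeneralLinearGroup.map j (ρ σ)) : Matrix (Fin 2) (Fin 2) K) =
          ((ρ σ : GL (Fin 2) (ZMod ℓ)) : Matrix (Fin 2) (Fin 2) (ZMod ℓ)).map j := rfl
      simp only [FramedRep.charpoly, FramedRep.baseChange_apply] at hch ⊢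
      rw [hmap, Matrix.charpoly_map, hch]
      simp only [Polynomial.map_add, Polynomial.map_sub, Polynomial.map_mul, Polynomial.map_pow,
        Polynomial.map_X, Polynomial.map_C]
      rw [map_intCast j, map_natCast j, map_intCast ι, map_natCast ι]

end PacketPort

/-- **M2 (= gen-3 H1; UNCONDITIONAL — PROVED).**  `ρ_{E,ℓ}` modular ⇒ every framed model of
`E[ℓ]` is modular — SAME prime, so no `ℓ`-hole: the packet of `IsModularGaloisRepTate ℓ` is off `N ℓ`,
exactly the exceptional set of `ModPGaloisRep.IsModular`.  M0 feeds the tree's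
`isModular_of_isNewform0_packet` with `b p := a_p(E)`; the curve side (unramified + Frobenius polynomial
mod `ℓ` at the good places off `N ℓ`) is the body of `IsModular.exists_isNewform0_packet` with the
conductor replaced by `N`.  Generalises `IsModular.isModular_of_isTorsionGaloisRep''`
(`BCDT.IsModular W` weakened to `W.IsModularGaloisRepTate ℓ`). -/
theorem isModular_torsion_of_isModularGaloisRepTate_self
    (W : WeierstrassCurve ℚ) [W.IsElliptic] (ℓ : ℕ) [Fact ℓ.Prime] (h : W.IsModularGaloisRepTate ℓ)
    {ρ : ModPGaloisRep ℚ (ZMod ℓ) 2} (hρ : W.IsTorsionGaloisRep ℓ ρ) : ρ.IsModular := by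
  have hℓp : ℓ.Prime := Fact.out
  obtain ⟨N, hN, f₀, hf₀, hgoodN, hap⟩ :=
    exists_isNewform0_hasGoodReductionAt_of_isModularGaloisRepTate W ℓ h
  have htr := W.trace_galoisRepTate_frobenius_of_hasGoodReductionAt_holds ℓ
  have hdet : W.det_galoisRepTate_frobenius_of_hasGoodReductionAt ℓ :=
    det_galoisRepTate_frobenius_of_hasGoodReductionAt_of_exists_weilPairing
      fun _ ↦ W.exists_weilPairing_holds _
  refine isModular_of_isNewform0_packet' hf₀ (b := fun p ↦ W.LFunction p)
    (fun p hp hpN ↦ hap p hp hpN) fun v hv ↦ ?_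
  have hpp : (primesEquiv v : ℕ).Prime := (primesEquiv v).2
  have hpℓ : (primesEquiv v : ℕ) ≠ ℓ := fun h' ↦ hv (by rw [← h']; exact dvd_mul_left _ _)
  have hgood : W.HasGoodReductionAt v := hgoodN v hv
  have hℓv : ((ℓ : ℕ) : 𝓞 ℚ) ∉ v.asIdeal := by
    rw [Literature.NumberTheory.GaloisRepresentations.Rat.natCast_mem_asIdeal_iff]
    exact fun h' ↦ hpℓ ((Nat.prime_dvd_prime_iff_eq hpp hℓp).mp h')
  refine ⟨hρ.isUnramifiedAt_of_hasGoodReductionAt hgood hℓv, ?_⟩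
  intro 𝔓 h𝔓 σ hσ
  have hch := hρ.charpoly_eq_of_isArithFrobAt htr hdet hℓv hgood h𝔓 hσ
  rw [natCard_residueField_adicCompletionIntegers,
    ← W.lFunction_primesEquiv_eq_frobeniusTraceAt hgood] at hch
  exact hch

/-- **M3 (= ideator-1's PROVED B1 ∘ B2, M ≈ 120 lines to land).**  A rational newform `f₀` carrying
`a_p(E)` at EVERY `p ∤ N`, with `E` good off `N`, IS the newform of `E`: realisations of `f₀` at
cofinally many `p` are the `V_p(E)` themselves (`ratGaloisRepCofinalAt_of_curve`), Carayol's Euler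
factor (`hCE`) at every `q ∣ N` read on inertia coinvariants of `V_p(E)` gives `a_q(f₀) = a_q(E)` and
`q ∣ N ↔ q ∣ N_E`, then the Hecke recursions (`isNewformOf_of_cofinalAt_of_carayolEuler`, `T₀ := N`). -/
theorem isNewformOf_of_packet_off_level_of_carayolEuler (hCE : Carayol1986_eulerFactor)
    (W : WeierstrassCurve ℚ) [W.IsElliptic] [NeZero (W.conductorNorm ℤ)] {N : ℕ} [NeZero N]
    (f₀ : CuspForm (Gamma0 N) 2) (hf₀ : IsNewform0 f₀)
    (hgood : ∀ v : HeightOneSpectrum (𝓞 ℚ), ¬ ((primesEquiv v : ℕ) ∣ N) → W.HasGoodReductionAt v)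
    (hap : ∀ p : ℕ, p.Prime → ¬ p ∣ N → cuspCoeff f₀ p = (W.LFunction p : ℂ)) :
    IsNewformOf W f₀ := by
  sorry

/-! ## Glue (kernel-checked) -/

/-- **The two-prime merge (M0 + M1): no hole.**  If `ρ_{E,ℓ₁}` and `ρ_{E,ℓ₂}` are modular for two
distinct primes, ONE newform `f₀ ∈ S₂(Γ₀(N))` carries `a_p(E)` for EVERY `p ∤ N`, and `E` is
good off `N`: the hole of each packet at its own prime is covered by the other packet. -/
theorem exists_isNewform0_packet_off_level_of_two_primes (W : WeierstrassCurve ℚ) [W.IsElliptic]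
    (ℓ₁ ℓ₂ : ℕ) [Fact ℓ₁.Prime] [Fact ℓ₂.Prime] (hne : ℓ₁ ≠ ℓ₂)
    (h₁ : W.IsModularGaloisRepTate ℓ₁) (h₂ : W.IsModularGaloisRepTate ℓ₂) :
    ∃ (N : ℕ) (_ : NeZero N) (f₀ : CuspForm (Gamma0 N) 2), IsNewform0 f₀ ∧
      (∀ v : HeightOneSpectrum (𝓞 ℚ), ¬ ((primesEquiv v : ℕ) ∣ N) → W.HasGoodReductionAt v) ∧
      ∀ p : ℕ, p.Prime → ¬ p ∣ N → cuspCoeff f₀ p = (W.LFunction p : ℂ) := by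
  have hℓ₁ : ℓ₁.Prime := Fact.out
  have hℓ₂ : ℓ₂.Prime := Fact.out
  obtain ⟨N₁, hN₁, f₁, hf₁, hgood₁, hap₁⟩ :=
    exists_isNewform0_hasGoodReductionAt_of_isModularGaloisRepTate W ℓ₁ h₁
  obtain ⟨N₂, hN₂, f₂, hf₂, hgood₂, hap₂⟩ :=
    exists_isNewform0_hasGoodReductionAt_of_isModularGaloisRepTate W ℓ₂ h₂
  have hM : N₁ * ℓ₁ * (N₂ * ℓ₂) ≠ 0 :=
    mul_ne_zero (mul_ne_zero (NeZero.ne N₁) hℓ₁.ne_zero) (mul_ne_zero (NeZero.ne N₂) hℓ₂.ne_zero)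
  have hagree : ∀ p : ℕ, p.Prime → ¬ p ∣ N₁ * ℓ₁ * (N₂ * ℓ₂) →
      cuspCoeff f₁ p = cuspCoeff f₂ p := by
    intro p hp hpM
    rw [hap₁ p hp fun h ↦ hpM (dvd_mul_of_dvd_left h _),
      hap₂ p hp fun h ↦ hpM (dvd_mul_of_dvd_right h _)]
  obtain ⟨hN, hcoeff⟩ := level_eq_and_cuspCoeff_eq_of_cuspCoeff_eq_off hf₁ hf₂ hM hagree
  subst hN
  refine ⟨N₁, hN₁, f₁, hf₁, fun v hv ↦ ?_, fun p hp hpN ↦ ?_⟩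
  · by_cases hv₁ : (primesEquiv v : ℕ) ∣ N₁ * ℓ₁
    · refine hgood₂ v fun hv₂ ↦ ?_
      have hq : (primesEquiv v : ℕ).Prime := (primesEquiv v).2
      have h1 : (primesEquiv v : ℕ) = ℓ₁ :=
        (Nat.prime_dvd_prime_iff_eq hq hℓ₁).mp ((hq.dvd_mul.mp hv₁).resolve_left hv)
      have h2 : (primesEquiv v : ℕ) = ℓ₂ :=
        (Nat.prime_dvd_prime_iff_eq hq hℓ₂).mp ((hq.dvd_mul.mp hv₂).resolve_left hv)
      exact hne (h1.symm.trans h2)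
    · exact hgood₁ v hv₁
  · by_cases hp₁ : p ∣ N₁ * ℓ₁
    · have h1 : p = ℓ₁ :=
        (Nat.prime_dvd_prime_iff_eq hp hℓ₁).mp ((hp.dvd_mul.mp hp₁).resolve_left hpN)
      have hp₂ : ¬ p ∣ N₁ * ℓ₂ := fun h' ↦ hne (h1.symm.trans
        ((Nat.prime_dvd_prime_iff_eq hp hℓ₂).mp ((hp.dvd_mul.mp h').resolve_left hpN)))
      rw [hcoeff p]
      exact hap₂ p hp hp₂
    · exact hap₁ p hp hp₁

/-- **(3)+(3′) ⇒ (2) for EVERY curve from TWO primes, Carayol only** (no Eichler–Shimura leaf). -/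
theorem isModular_of_isModularGaloisRepTate_two_primes (hCE : Carayol1986_eulerFactor)
    (hC : ∀ (N : ℕ) [NeZero N], IsNewformOf.level_eq_conductorNorm (N := N))
    (W : WeierstrassCurve ℚ) [W.IsElliptic] [NeZero (W.conductorNorm ℤ)]
    (ℓ₁ ℓ₂ : ℕ) [Fact ℓ₁.Prime] [Fact ℓ₂.Prime] (hne : ℓ₁ ≠ ℓ₂)
    (h₁ : W.IsModularGaloisRepTate ℓ₁) (h₂ : W.IsModularGaloisRepTate ℓ₂) : BCDT.IsModular W := by
  obtain ⟨N, hN, f₀, hf₀, hgood, hap⟩ :=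
    exists_isNewform0_packet_off_level_of_two_primes W ℓ₁ ℓ₂ hne h₁ h₂
  have hWf : IsNewformOf W f₀ :=
    isNewformOf_of_packet_off_level_of_carayolEuler hCE W f₀ hf₀ hgood hap
  have hNE : N = W.conductorNorm ℤ := hC N hWf
  subst hNE
  exact ⟨f₀, hWf⟩

/-- **`h32CS ⇐ {Carayol1986_eulerFactor, level = conductor}`** (primes `3`, `5`). -/
theorem sigThreeImpTwoCS_of_carayolEuler_of_level (hCE : Carayol1986_eulerFactor)
    (hC : ∀ (N : ℕ) [NeZero N], IsNewformOf.level_eq_conductorNorm (N := N)) :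
    SigThreeImpTwoCS := by
  intro W _ _ h
  haveI : Fact (Nat.Prime 3) := ⟨Nat.prime_three⟩
  exact isModular_of_isModularGaloisRepTate_two_primes hCE hC W 3 5 (by decide) (h 3) (h 5)

/-- **`h32FCS ⇐ {Carayol1986_eulerFactor, FreyLevelEqConductor}`**. -/
theorem sigThreeImpTwoFreyCS_of_carayolEuler_of_freyLevel (hCE : Carayol1986_eulerFactor)
    (hLF : FreyLevelEqConductor) : SigThreeImpTwoFreyCS := by
  intro a b hab h0 _ _ h
  haveI : Fact (Nat.Prime 3) := ⟨Nat.prime_three⟩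
  obtain ⟨N, hN, f₀, hf₀, hgood, hap⟩ :=
    exists_isNewform0_packet_off_level_of_two_primes (freyCurve a b) 3 5 (by decide) (h 3) (h 5)
  have hWf : IsNewformOf (freyCurve a b) f₀ :=
    isNewformOf_of_packet_off_level_of_carayolEuler hCE (freyCurve a b) f₀ hf₀ hgood hap
  have hNE : N = (freyCurve a b).conductorNorm ℤ := hLF a b hab h0 hWf
  subst hNE
  exact ⟨f₀, hWf⟩

/-- **I2 at torsion level, NO named fact**: Tate-modular at every prime ⇒ every framed model of every
`E[ℓ]` is modular (M2 at the torsion prime itself). -/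
theorem isModular_torsion_of_isModularGaloisRepTateAll (W : WeierstrassCurve ℚ) [W.IsElliptic]
    (h : IsModularGaloisRepTateAll W) {ℓ : ℕ} [Fact ℓ.Prime] {ρ : ModPGaloisRep ℚ (ZMod ℓ) 2}
    (hρ : W.IsTorsionGaloisRep ℓ ρ) : ρ.IsModular :=
  isModular_torsion_of_isModularGaloisRepTate_self W ℓ (h ℓ) hρ

/-! ## The recut composition (kernel-checked): S9 never applied to the switched curve -/

/-- **Every Frey curve is modular from the CS-RECUT stub set** `{S1a, S1b-CS, S2-CS, h32FCS, S3}`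
(plus the skeleton's Frey inputs `h4a`, `h4b`, `h6`, `h9`, `h25`): CDT 1999, proof of Thm. 7.1.2
(p. 556), with the modularity of `ρ̄_{E,5} = ρ̄_{W',5}` read off `W'` Tate-modular AT `5` (M2) —
no `BCDT.IsModular W'`, hence no Carayol / Eichler–Shimura for the arbitrary-conductor curve `W'`. -/
theorem isModular_freyCurve_of_recutCS
    (hmod3 : ∀ (W : WeierstrassCurve ℚ) [W.IsElliptic] (ρ : ModPGaloisRep ℚ (ZMod 3) 2),
      W.IsTorsionGaloisRep 3 ρ → FramedRep.IsAbsolutelyIrreducible ρ → ρ.IsModular)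
    (hlift3 : SigLiftThreeCS) (hlift5 : SigLiftFiveCS) (h32 : SigThreeImpTwoFreyCS)
    (h3 : ∀ (W : WeierstrassCurve ℚ) [W.IsElliptic], ¬ 27 ∣ W.conductorNorm ℤ →
      (∀ ρ₃ : ModPGaloisRep ℚ (ZMod 3) 2, W.IsTorsionGaloisRep 3 ρ₃ →
        ¬ ρ₃.IsAbsIrreducibleOverSqrt (-3)) →
      ∀ (ρ : ModPGaloisRep ℚ (ZMod 5) 2), W.IsTorsionGaloisRep 5 ρ → ρ.IsAbsIrreducibleOverSqrt 5 →
      ∃ (W' : WeierstrassCurve ℚ) (_ : W'.IsElliptic), W'.IsTorsionGaloisRep 5 ρ ∧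
        ∃ ρ₃' : ModPGaloisRep ℚ (ZMod 3) 2, W'.IsTorsionGaloisRep 3 ρ₃' ∧
          ρ₃'.IsAbsIrreducibleOverSqrt (-3))
    (h4a : ∀ a b : ℤ, IsCoprime a b → a * b * (a + b) ≠ 0 →
      ∀ ρ : ModPGaloisRep ℚ (ZMod 5) 2, (freyCurve a b).IsTorsionGaloisRep 5 ρ →
        FramedRep.IsIrreducible ρ)
    (h4b : ∀ (W : WeierstrassCurve ℚ) [W.IsElliptic], ¬ 25 ∣ W.conductorNorm ℤ →
      ∀ ρ : ModPGaloisRep ℚ (ZMod 5) 2, W.IsTorsionGaloisRep 5 ρ →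
        FramedRep.IsIrreducible ρ → ρ.IsAbsIrreducibleOverSqrt 5)
    (h6 : ∀ (W W' : WeierstrassCurve ℚ) [W.IsElliptic] [W'.IsElliptic]
      (ρ : ModPGaloisRep ℚ (ZMod 5) 2),
      W.IsTorsionGaloisRep 5 ρ → W'.IsTorsionGaloisRep 5 ρ →
      ¬ 9 ∣ W.conductorNorm ℤ → ¬ 9 ∣ W'.conductorNorm ℤ)
    {a b : ℤ} (hab : IsCoprime a b) (h0 : a * b * (a + b) ≠ 0)
    [NeZero ((freyCurve a b).conductorNorm ℤ)]
    (h9 : ¬ 9 ∣ (freyCurve a b).conductorNorm ℤ) (h25 : ¬ 25 ∣ (freyCurve a b).conductorNorm ℤ) :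
    BCDT.IsModular (freyCurve a b) := by
  haveI := isElliptic_freyCurve h0
  -- case A: `ρ̄_{E,3}|ℚ(√-3)` absolutely irreducible for some framed model — S1a + S1b-CS + h32FCS
  by_cases hA : ∃ ρ₃ : ModPGaloisRep ℚ (ZMod 3) 2,
      (freyCurve a b).IsTorsionGaloisRep 3 ρ₃ ∧ ρ₃.IsAbsIrreducibleOverSqrt (-3)
  · obtain ⟨ρ₃, hρ₃, h3i⟩ := hA
    exact h32 a b hab h0
      (hlift3 (freyCurve a b) ρ₃ hρ₃ h3i h9
        (hmod3 (freyCurve a b) ρ₃ hρ₃ h3i.isAbsolutelyIrreducible))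
  -- case B
  have hB : ∀ ρ₃ : ModPGaloisRep ℚ (ZMod 3) 2, (freyCurve a b).IsTorsionGaloisRep 3 ρ₃ →
      ¬ ρ₃.IsAbsIrreducibleOverSqrt (-3) := fun ρ₃ hρ₃ h3i ↦ hA ⟨ρ₃, hρ₃, h3i⟩
  have h27 : ¬ 27 ∣ (freyCurve a b).conductorNorm ℤ := fun h27 ↦ h9 (dvd_trans ⟨3, rfl⟩ h27)
  obtain ⟨ρ, hρ⟩ := (freyCurve a b).exists_isTorsionGaloisRep 5
  have hirr : FramedRep.IsIrreducible ρ := h4a a b hab h0 ρ hρ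
  have h5 : ρ.IsAbsIrreducibleOverSqrt 5 := h4b (freyCurve a b) h25 ρ hρ hirr
  -- the `3`–`5` switch
  obtain ⟨W', hW', hρ', ρ₃', hρ₃', h3i'⟩ := h3 (freyCurve a b) h27 hB ρ hρ h5
  haveI := hW'
  have h9' : ¬ 9 ∣ W'.conductorNorm ℤ := h6 (freyCurve a b) W' ρ hρ hρ' h9
  -- `W'` is Tate-modular at EVERY prime (S1a + S1b-CS) …
  have hall' : IsModularGaloisRepTateAll W' :=
    hlift3 W' ρ₃' hρ₃' h3i' h9' (hmod3 W' ρ₃' hρ₃' h3i'.isAbsolutelyIrreducible)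
  -- … in particular at `5`, so `ρ̄ = ρ̄_{E,5} = ρ̄_{W',5}` is modular (M2; no (3) ⇒ (2) for `W'`)
  have hρmod : ρ.IsModular := isModular_torsion_of_isModularGaloisRepTateAll W' hall' hρ'
  -- and `E` is modular by S2-CS + h32FCS
  exact h32 a b hab h0 (hlift5 (freyCurve a b) ρ hρ h5 h25 hρmod)

/-- **The crux BY NAME from the CS-recut stubs** (via the landed iff
`freyModularity_iff_forall_isModular_freyCurve`; `h9`, `h25` from the landed
`not_nine_dvd_conductorNorm_freyCurve` and the skeleton's `not_twentyFive_dvd_conductorNorm_freyCurve`). -/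
theorem freyModularity_of_recutCS
    (hmod3 : ∀ (W : WeierstrassCurve ℚ) [W.IsElliptic] (ρ : ModPGaloisRep ℚ (ZMod 3) 2),
      W.IsTorsionGaloisRep 3 ρ → FramedRep.IsAbsolutelyIrreducible ρ → ρ.IsModular)
    (hlift3 : SigLiftThreeCS) (hlift5 : SigLiftFiveCS) (h32 : SigThreeImpTwoFreyCS)
    (h3 : CDT_three_five_switch)
    (h4a : ∀ a b : ℤ, IsCoprime a b → a * b * (a + b) ≠ 0 →
      ∀ ρ : ModPGaloisRep ℚ (ZMod 5) 2, (freyCurve a b).IsTorsionGaloisRep 5 ρ →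
        FramedRep.IsIrreducible ρ)
    (h4b : ∀ (W : WeierstrassCurve ℚ) [W.IsElliptic], ¬ 25 ∣ W.conductorNorm ℤ →
      ∀ ρ : ModPGaloisRep ℚ (ZMod 5) 2, W.IsTorsionGaloisRep 5 ρ →
        FramedRep.IsIrreducible ρ → ρ.IsAbsIrreducibleOverSqrt 5)
    (h6 : ∀ (W W' : WeierstrassCurve ℚ) [W.IsElliptic] [W'.IsElliptic]
      (ρ : ModPGaloisRep ℚ (ZMod 5) 2),
      W.IsTorsionGaloisRep 5 ρ → W'.IsTorsionGaloisRep 5 ρ →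
      ¬ 9 ∣ W.conductorNorm ℤ → ¬ 9 ∣ W'.conductorNorm ℤ)
    (h25 : ∀ a b : ℤ, IsCoprime a b → a * b * (a + b) ≠ 0 →
      ¬ 25 ∣ (freyCurve a b).conductorNorm ℤ) :
    Summit.ABC.ABC.Theses.DefiniteXi.FreyModularity :=
  Summit.ABC.ABC.Theorems.freyModularity_iff_forall_isModular_freyCurve.mpr
    fun _ _ hab h0 _ ↦ isModular_freyCurve_of_recutCS hmod3 hlift3 hlift5 h32 h3 h4a h4b h6 hab h0
      (Summit.ABC.ABC.Theorems.not_nine_dvd_conductorNorm_freyCurve hab h0) (h25 _ _ hab h0)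

/-- **Closing set of the CS-recut line** — four catalogued named facts + Carayol's Euler factor +
level = conductor on the Frey family; NO Eichler–Shimura construction, NO `L_A`, NO Igusa.  The Frey
binders are the skeleton's own LANDED inputs: `h4a := Summit.ABC.ABC.Theorems.isIrreducible_freyCurve_five`
(reshape 3), `h4b := Summit.ABC.ABC.Theorems.stub_absIrrSqrtFive` (p102499),
`h6 := Summit.ABC.ABC.Theorems.stub_nineTransfer` (p110220),
`h25 := Summit.ABC.ABC.Theorems.not_twentyFive_dvd_conductorNorm_freyCurve` — kept as binders here
only because their module chain (`…StubAbsIrrSqrtFiveGroup`) is unbuilt on the current farm snapshot. -/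
theorem freyModularity_of_recutCS_atoms
    (hLT : ∀ σ : FramedArtinRep ℚ 2, Literature.NumberTheory.Automorphic.langlands_tunnell σ)
    (h721 : CDT_theorem_7_2_1) (h722 : CDT_theorem_7_2_2) (hsw : CDT_three_five_switch)
    (hCE : Carayol1986_eulerFactor) (hLF : FreyLevelEqConductor)
    (h4a : ∀ a b : ℤ, IsCoprime a b → a * b * (a + b) ≠ 0 →
      ∀ ρ : ModPGaloisRep ℚ (ZMod 5) 2, (freyCurve a b).IsTorsionGaloisRep 5 ρ →
        FramedRep.IsIrreducible ρ)
    (h4b : ∀ (W : WeierstrassCurve ℚ) [W.IsElliptic], ¬ 25 ∣ W.conductorNorm ℤ →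
      ∀ ρ : ModPGaloisRep ℚ (ZMod 5) 2, W.IsTorsionGaloisRep 5 ρ →
        FramedRep.IsIrreducible ρ → ρ.IsAbsIrreducibleOverSqrt 5)
    (h6 : ∀ (W W' : WeierstrassCurve ℚ) [W.IsElliptic] [W'.IsElliptic]
      (ρ : ModPGaloisRep ℚ (ZMod 5) 2),
      W.IsTorsionGaloisRep 5 ρ → W'.IsTorsionGaloisRep 5 ρ →
      ¬ 9 ∣ W.conductorNorm ℤ → ¬ 9 ∣ W'.conductorNorm ℤ)
    (h25 : ∀ a b : ℤ, IsCoprime a b → a * b * (a + b) ≠ 0 →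
      ¬ 25 ∣ (freyCurve a b).conductorNorm ℤ) :
    Summit.ABC.ABC.Theses.DefiniteXi.FreyModularity :=
  freyModularity_of_recutCS (modThree_of_langlands_tunnell hLT)
    (sigLiftThreeCS_of_CDT_theorem_7_2_1 h721) (sigLiftFiveCS_of_CDT_theorem_7_2_2 h722)
    (sigThreeImpTwoFreyCS_of_carayolEuler_of_freyLevel hCE hLF) hsw h4a h4b h6 h25

end Summit.ABC.ABC.Cruxes.FreyModularity.Sketch.StubIdeasThreeImpTwo2G4

end
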